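import Summits.NavierStokesRegularity.FluidComputer.ClayBlowupOfBreakdown
import Summits.NavierStokesRegularity.FluidComputer.ForcedContinuationRate
import HarnessLib

/-!
# The E–C compatibility list on `ClayBlowup ν` — i.e. on EVERY breakdown scenario for (C)

Cell `ns-blowup`, seat `ns-blowup-ecbridge-2` (g5; the E–C endpoint theory seat). LABEL: E–C typing
(KERNEL — no named fact). WHAT THIS IS NOT: not Navier–Stokes evidence — necessary conditions on the
TYPE `ClayBlowup` (no inhabitant is claimed anywhere). Companion memo:
`run/shared/lean/pub/ns-blowup/ecbridge2/ECBRIDGE-2-MEMO-4.md`.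

## Content

`ClayBlowupOfBreakdown.lean` proved `NavierStokesBreakdownR3 ↔ ∃ ν > 0, Nonempty (ClayBlowup ν)`:
Fefferman's (C) IS the inhabitation of the weakest E–C type. This file re-issues the seat's
compatibility rows on that type, so that they bind every breakdown scenario whatsoever. For
`X : ClayBlowup ν`, `ν > 0`:

* `energy_dissipation_le_of_clayForce` (raw fields) / `ClayBlowup.energy_le`,
  `ClayBlowup.lintegral_dissipation_lt_top` — ROW R10: ONE finite `E` bounds `∫|u(t)|²` on `[0, T)`
  AND `ν ∫₀ᵀ∫|∇u|² ≤ E` (Tao's Lemma 8.1 with force, a tree theorem; the blow-up is never an energy or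
  dissipation blow-up);
* `ClayBlowup.hasBoundedSobolevNormsOn` — Tao's spatial class on every closed sub-slab;
* `ClayBlowup.velocity_unbounded`, `exists_norm_gt`, `exists_norm_gt_near` — the `L^∞` criterion;
* `ClayBlowup.not_exists_enstrophy_bound`, `exists_enstrophy_gt` — the `H¹` alternative;
* `ForcedContinuation.lifespan_le_of_no_finiteEnergyExtension` — Tao's quantitative lifespan at every
  time of a solution WITHOUT FINITE-ENERGY extension (the stronger form of
  `lifespan_le_of_no_extension`), and `ClayBlowup.enstrophy_rate` — Leray's `H¹` rate;
* `breakdownR3_necessary` — the headline: (C) ⇒ at every `ν > 0` some Clay datum and Clay force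
  evolve classically with bounded energy and finite dissipation up to a finite time at which BOTH
  `sup_x |u|` and `∫|∇u|²` blow up.

References: J. Leray, Acta Math. 63 (1934), (3.16), §32 [cite: Leray1934, (3.16)]; T. Tao, Anal. PDE
6 (2013), Thm. 5.4, Lemma 8.1, Cor. 11.1 [cite: Tao2011, Thm. 5.4 (ii)+(iv)]; P. G. Lemarié-Rieusset
(2016), Thm. 7.2, Thm. 11.2 [cite: LemarieRieusset2016, Thm. 11.2]; C. L. Fefferman, Clay problem
description, (C) [cite: FeffermanClay2006, (C)].
-/

noncomputable section

namespace Summit.NavierStokesRegularity.FluidComputer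

open Set MeasureTheory Filter Topology Function
open scoped ENNReal ContDiff NNReal
open Literature.Analysis.FluidPDE
open Summit.NavierStokesRegularity.NavierStokesRegularity
open Summit.NavierStokesRegularity.FluidComputer.PalasekTowerClayBridge

/-! ## §1 ROW R10 for raw fields: uniform energy and dissipation through the end of the slab -/

/-- **Tao's Lemma 8.1 with force along a half-open slab, with ONE bound** (`ν > 0`): a classical
forced solution on `[0, T) × ℝ³` with finite energy on every closed sub-slab and a Clay force has a
finite `E` with `∫|u(t)|² ≤ E` for EVERY `t ∈ [0, T)` and `ν ∫₀ᵀ∫|∇u|² ≤ E` (the right-hand side of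
Lemma 8.1 on `[0, T']` is `C(‖u(0)‖₂ + ‖f‖_{L¹_t L²_x[0,T']})²`, bounded independently of `T'` by
the `L¹_t L²_x` bound of the Clay force; then monotone convergence along `T' ↑ T`). No named fact.
[cite: Tao2011, Lemma 8.1] [cite: FeffermanClay2006, (5)] -/
theorem energy_dissipation_le_of_clayForce {ν T : ℝ} (hν : 0 < ν) (hT : 0 < T)
    {u f : ℝ → EuclideanSpace ℝ (Fin 3) → EuclideanSpace ℝ (Fin 3)}
    {p : ℝ → EuclideanSpace ℝ (Fin 3) → ℝ} (hsol : IsClassicalNSSolutionOn (Ico 0 T) ν f u p)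
    (hfs : IsSmoothOnHalfSpace f) (hfd : HasRapidSpaceTimeDecay f)
    (energy : ∀ T', T' < T → ∃ C : ℝ≥0∞, C < ⊤ ∧ ∀ t ∈ Icc 0 T', ∫⁻ x, ‖u t x‖ₑ ^ 2 ≤ C) :
    ∃ E : ℝ≥0∞, E < ⊤ ∧ (∀ t ∈ Ico 0 T, ∫⁻ x, ‖u t x‖ₑ ^ 2 ≤ E) ∧
      ENNReal.ofReal ν *
        ∫⁻ t in Ioo 0 T, ∫⁻ x, ENNReal.ofReal (frobeniusNormSq (fderiv ℝ (u t) x)) ≤ E := by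
  obtain ⟨C, hC, H⟩ := tao2011_forced_finiteEnergy_energyBound_holds
  obtain ⟨F, hFt, hF⟩ := ClayEvolution.clayForce_lintegral_sqrt_energy_le hfd
  obtain ⟨A₀, hA₀, hA₀b⟩ := energy (T / 2) (by linarith)
  have hu0 : ∫⁻ x, ‖u 0 x‖ₑ ^ 2 < ⊤ := (hA₀b 0 ⟨le_rfl, by linarith⟩).trans_lt hA₀
  set E : ℝ≥0∞ := C * ((∫⁻ x, ‖u 0 x‖ₑ ^ 2) ^ (1 / 2 : ℝ) + F) ^ 2 with hE
  have hEt : E < ⊤ := by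
    refine ENNReal.mul_lt_top hC (ENNReal.pow_lt_top (ENNReal.add_lt_top.2 ⟨?_, hFt⟩))
    exact ENNReal.rpow_lt_top_of_nonneg (by norm_num) hu0.ne
  -- Lemma 8.1 on a closed sub-slab `[0, T']`, with the `T'`-independent right-hand side
  have key : ∀ T' ∈ Ioo 0 T,
      (∀ t ∈ Icc 0 T', ∫⁻ x, ‖u t x‖ₑ ^ 2 ≤ E) ∧
        ENNReal.ofReal ν *
          ∫⁻ t in Ioo 0 T', ∫⁻ x, ENNReal.ofReal (frobeniusNormSq (fderiv ℝ (u t) x)) ≤ E := by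
    intro T' hT'
    have hsol' : IsClassicalNSSolutionOn (Icc 0 T') ν f u p :=
      hsol.mono (Icc_subset_Ico_right hT'.2) (uniqueDiffOn_Icc hT'.1)
    have hfs' : IsSmoothSpaceTimeOn (Icc 0 T') f := hfs.isSmoothSpaceTimeOn_Icc T'
    have hfE : ∫⁻ t in Icc 0 T', (∫⁻ x, ‖f t x‖ₑ ^ 2) ^ (1 / 2 : ℝ) < ⊤ := (hF T').trans_lt hFt
    obtain ⟨A, hAt, hA⟩ := energy T' hT'.2
    have hE' : ∃ A : ℝ≥0, ∀ t ∈ Icc 0 T', ∫⁻ x, ‖u t x‖ₑ ^ 2 ≤ A :=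
      ⟨A.toNNReal, fun t ht => (hA t ht).trans (ENNReal.coe_toNNReal hAt.ne).ge⟩
    obtain ⟨h1, h2⟩ := H hν hT'.1 hsol' hfs' hfE hE'
    have hrhs : C * ((∫⁻ x, ‖u 0 x‖ₑ ^ 2) ^ (1 / 2 : ℝ) +
        ∫⁻ t in Icc 0 T', (∫⁻ x, ‖f t x‖ₑ ^ 2) ^ (1 / 2 : ℝ)) ^ 2 ≤ E := by
      rw [hE]
      gcongr
      exact hF T'
    exact ⟨fun t ht => (h1 t ht).trans hrhs, h2.trans hrhs⟩
  refine ⟨E, hEt, fun t ht => ?_, ?_⟩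
  · exact (key ((t + T) / 2) ⟨by linarith [ht.1], by linarith [ht.2]⟩).1 t
      ⟨ht.1, by linarith [ht.2]⟩
  -- exhaust `(0, T)` by the slabs `(0, T - T/(n+2))`
  set Tn : ℕ → ℝ := fun n => T - T / (n + 2) with hTn
  have hTn_pos : ∀ n, 0 < Tn n := fun n => by
    have h2 : (2 : ℝ) ≤ (n : ℝ) + 2 := by
      have := (Nat.cast_nonneg n : (0 : ℝ) ≤ (n : ℝ)); linarith
    have : T / (n + 2) ≤ T / 2 := div_le_div_of_nonneg_left hT.le (by norm_num) h2
    simp only [hTn]; linarith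
  have hTn_lt : ∀ n, Tn n < T := fun n => by
    simp only [hTn]
    have : 0 < T / (n + 2) := div_pos hT (by positivity)
    linarith
  have hTn_mono : Monotone Tn := fun m n hmn => by
    simp only [hTn]
    have : T / (n + 2) ≤ T / (m + 2) :=
      div_le_div_of_nonneg_left hT.le (by positivity) (by exact_mod_cast Nat.add_le_add_right hmn 2)
    linarith
  have hmonoI : Monotone fun n => Ioo (0 : ℝ) (Tn n) := fun m n hmn =>
    Ioo_subset_Ioo_right (hTn_mono hmn)
  have hdir : Directed (· ⊆ ·) fun n => Ioo (0 : ℝ) (Tn n) := hmonoI.directed_le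
  have hU : (⋃ n, Ioo (0 : ℝ) (Tn n)) = Ioo 0 T := by
    refine Subset.antisymm (iUnion_subset fun n => Ioo_subset_Ioo_right (hTn_lt n).le) fun t ht => ?_
    obtain ⟨n, hn⟩ := exists_nat_gt (T / (T - t))
    have hTt : 0 < T - t := sub_pos.2 ht.2
    refine mem_iUnion.2 ⟨n, ht.1, ?_⟩
    simp only [hTn]
    have hn2 : T / (T - t) < (n : ℝ) + 2 := by linarith
    have : T / ((n : ℝ) + 2) < T - t := by
      rw [div_lt_iff₀ (by positivity)]
      have h1 : T = T / (T - t) * (T - t) := by field_simp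
      have h2 : T / (T - t) * (T - t) < ((n : ℝ) + 2) * (T - t) :=
        mul_lt_mul_of_pos_right hn2 hTt
      linarith [mul_comm ((n : ℝ) + 2) (T - t)]
    linarith
  rw [← hU, setLIntegral_iUnion_of_directed _ hdir, ENNReal.mul_iSup]
  exact iSup_le fun n => (key (Tn n) ⟨hTn_pos n, hTn_lt n⟩).2

namespace ClayBlowup

variable {ν : ℝ} (X : ClayBlowup ν)

/-! ## §2 ROW R10 and Tao's spatial class on the type -/

/-- **ONE finite bound for the energy on `[0, T)` and the dissipation up to `T` of a Clay blow-up**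
(`ν > 0`; no named fact). [cite: Tao2011, Lemma 8.1] -/
theorem energy_dissipation_le (hν : 0 < ν) :
    ∃ E : ℝ≥0∞, E < ⊤ ∧ (∀ t ∈ Ico 0 X.T, ∫⁻ x, ‖X.u t x‖ₑ ^ 2 ≤ E) ∧
      ENNReal.ofReal ν *
        ∫⁻ t in Ioo 0 X.T, ∫⁻ x, ENNReal.ofReal (frobeniusNormSq (fderiv ℝ (X.u t) x)) ≤ E :=
  energy_dissipation_le_of_clayForce hν X.T_pos X.classical X.force_smooth X.force_decay X.energy

/-- **Uniform energy bound on `[0, T)`** for a Clay blow-up (`ν > 0`; no named fact).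
[cite: Tao2011, Lemma 8.1] -/
theorem energy_le (hν : 0 < ν) :
    ∃ E : ℝ≥0∞, E < ⊤ ∧ ∀ t ∈ Ico 0 X.T, ∫⁻ x, ‖X.u t x‖ₑ ^ 2 ≤ E := by
  obtain ⟨E, hEt, hEn, -⟩ := X.energy_dissipation_le hν
  exact ⟨E, hEt, hEn⟩

/-- **Integrable dissipation THROUGH the lifespan** of a Clay blow-up: `∫₀ᵀ∫|∇u|² < ∞` (`ν > 0`; no
named fact). [cite: Tao2011, Lemma 8.1] -/
theorem lintegral_dissipation_lt_top (hν : 0 < ν) :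
    ∫⁻ t in Ioo 0 X.T, ∫⁻ x, ENNReal.ofReal (frobeniusNormSq (fderiv ℝ (X.u t) x)) < ⊤ := by
  obtain ⟨E, hEt, -, hdis⟩ := X.energy_dissipation_le hν
  have hν' : ENNReal.ofReal ν ≠ 0 := (ENNReal.ofReal_pos.2 hν).ne'
  rcases ENNReal.mul_lt_top_iff.1 (hdis.trans_lt hEt) with h | h | h
  · exact h.2
  · exact absurd h hν'
  · rw [h]; exact ENNReal.zero_lt_top

/-- **A Clay blow-up lies in Tao's class `L^∞_t H^k_x([0,T'] × ℝ³)` for every `k` and every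
`0 < T' < T`** (`ν > 0`; lit g10's fact-free `hasBoundedSobolevNormsOn_of_clayForce`).
[cite: Tao2011, Cor. 11.1] -/
theorem hasBoundedSobolevNormsOn (hν : 0 < ν) {T' : ℝ} (hT'0 : 0 < T') (hT' : T' < X.T) :
    HasBoundedSobolevNormsOn (Icc 0 T') X.u := by
  obtain ⟨C, hCt, hC⟩ := X.energy T' hT'
  exact (X.classical_Icc hT'0 hT').hasBoundedSobolevNormsOn_of_clayForce hν hT'0
    ⟨C.toNNReal, fun t ht => (hC t ht).trans (ENNReal.coe_toNNReal hCt.ne).ge⟩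
    X.datum_decay X.force_smooth X.force_decay

/-- The slab-quantified form of the Tao class. [cite: Tao2011, Cor. 11.1] -/
theorem hasBoundedSobolevNormsOn_subslabs (hν : 0 < ν) :
    ∀ T' ∈ Ioo 0 X.T, HasBoundedSobolevNormsOn (Icc 0 T') X.u :=
  fun _ hT' => X.hasBoundedSobolevNormsOn hν hT'.1 hT'.2

/-! ## §3 The `L^∞` criterion -/

/-- **A Clay blow-up is NOT bounded on `[0, T) × ℝ³`** (`ν > 0`): if it were, ecbridge-1's half-open
continuation (fed the tree theorem F2) would give a FINITE-ENERGY classical extension to a closed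
slab `[0, T']`, `T' > T`, which `no_energy_extension` forbids. No named fact.
[cite: LemarieRieusset2016, Thm. 11.2] [cite: Tao2011, Thm. 5.4 (ii)+(iv)] -/
theorem velocity_unbounded (hν : 0 < ν) : ¬ ∃ M : ℝ, ∀ t ∈ Ico 0 X.T, ∀ x, ‖X.u t x‖ ≤ M := by
  rintro ⟨M, hM⟩
  obtain ⟨T', hT', U, P, hcl, hUu, hE⟩ :=
    ForcedContinuation.exists_forced_extension_of_bounded_Ico tao2011_smooth_local_existence_forced_holds
      hν X.T_pos X.force_smooth X.force_decay X.classical (X.energy_le hν) hM X.datum_decay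
  exact X.no_energy_extension (hasFiniteEnergyExtensionPast_of_Icc hT' hcl hUu hE)

/-- **For every bound `M` some point of `[0, T) × ℝ³` beats it.** [cite: Leray1934, (3.16)] -/
theorem exists_norm_gt (hν : 0 < ν) (M : ℝ) : ∃ t ∈ Ico 0 X.T, ∃ x, M < ‖X.u t x‖ := by
  by_contra h
  refine X.velocity_unbounded hν ⟨M, fun t ht x => ?_⟩
  exact not_lt.1 fun hlt => h ⟨t, ht, x, hlt⟩

/-- **The sup norm blows up AT `T`**: for every `t₀ < T` and every `M` some `(t, x)` with
`t₀ < t < T` has `‖u(t, x)‖ > M` (on `[0, t₀]` the blow-up is bounded, `exists_norm_le`).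
[cite: Leray1934, (3.16)] -/
theorem exists_norm_gt_near (hν : 0 < ν) {t₀ : ℝ} (ht₀ : t₀ < X.T) (M : ℝ) :
    ∃ t ∈ Ioo t₀ X.T, ∃ x, M < ‖X.u t x‖ := by
  obtain ⟨B, hB⟩ := X.exists_norm_le hν ht₀
  obtain ⟨t, ht, x, hx⟩ := X.exists_norm_gt hν (max M B)
  rcases le_or_gt t t₀ with htt₀ | htt₀
  · exact absurd ((le_max_right M B).trans_lt hx) (not_lt.2 (hB t ⟨ht.1, htt₀⟩ x))
  · exact ⟨t, ⟨htt₀, ht.2⟩, x, (le_max_left M B).trans_lt hx⟩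

/-! ## §4 The `H¹` alternative -/

/-- **The enstrophy of a Clay blow-up is NOT bounded on `[0, T)`** (`ν > 0`): a uniform enstrophy
bound would give a FINITE-ENERGY classical extension to a closed slab past `T`
(`ForcedContinuation.exists_forced_extension_of_enstrophy_bounded_Ico`, fed F2). No named fact, no
hypothesis on `∂ₜu` or on any pressure. [cite: LemarieRieusset2016, Thm. 7.2]
[cite: Tao2011, Thm. 5.4 (ii)+(iv)] -/
theorem not_exists_enstrophy_bound (hν : 0 < ν) :
    ¬ ∃ B : ℝ≥0, ∀ t ∈ Ico 0 X.T,
        ∫⁻ x, ENNReal.ofReal (frobeniusNormSq (fderiv ℝ (X.u t) x)) ≤ B := by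
  rintro ⟨B, hB⟩
  obtain ⟨T', hT', U, P, hcl, hUu, hE⟩ :=
    ForcedContinuation.exists_forced_extension_of_enstrophy_bounded_Ico
      tao2011_smooth_local_existence_forced_holds hν X.T_pos X.force_smooth X.force_decay X.classical
      (X.energy_le hν) ⟨B, ENNReal.coe_lt_top, hB⟩ (X.hasBoundedSobolevNormsOn_subslabs hν)
  exact X.no_energy_extension (hasFiniteEnergyExtensionPast_of_Icc hT' hcl hUu hE)

/-- **Unbounded enstrophy at the lifespan**: for every `B` some slice `t < T` has `∫|∇u(t)|² > B`.
[cite: LemarieRieusset2016, Thm. 7.2] -/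
theorem exists_enstrophy_gt (hν : 0 < ν) (B : ℝ≥0) :
    ∃ t ∈ Ico 0 X.T, (B : ℝ≥0∞) < ∫⁻ x, ENNReal.ofReal (frobeniusNormSq (fderiv ℝ (X.u t) x)) := by
  by_contra h
  refine X.not_exists_enstrophy_bound hν ⟨B, fun t ht => ?_⟩
  exact not_lt.1 fun hlt => h ⟨t, ht, hlt⟩

end ClayBlowup

/-! ## §5 Leray's `H¹` rate under the weaker maximality -/

namespace PalasekTowerClayBridge.ForcedContinuation

variable {ν τ : ℝ} {f u : ℝ → EuclideanSpace ℝ (Fin 3) → EuclideanSpace ℝ (Fin 3)}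
  {p : ℝ → EuclideanSpace ℝ (Fin 3) → ℝ}

/-- **Tao's lifespan bound at every time of a solution WITHOUT FINITE-ENERGY EXTENSION** (the
stronger form of `lifespan_le_of_no_extension`: the restart of F2 at `t₀` produces a FINITE-ENERGY
extension, so only those need to be excluded). `(u, p)` classical on `[0, τ) × ℝ³` (`ν > 0`, Clay
force), uniform energy `≤ E₀ < ⊤`, Tao's spatial class on closed sub-slabs,
`¬ HasFiniteEnergyExtensionPast`; then with Tao's absolute `c > 0` and the force's slab `H¹` size
`B ≥ 0`: `min(1, c ν³ / (√((E₀ + ∫|∇u(t₀)|²).toReal) + B + 1)⁴) ≤ τ − t₀` for every `t₀ ∈ [0, τ)`.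
No named fact (F2 is a tree theorem). [cite: Tao2011, Thm. 5.4 (ii)+(iv)] [cite: Leray1934, (3.16)] -/
theorem lifespan_le_of_no_finiteEnergyExtension (hν : 0 < ν)
    (hs : IsSmoothOnHalfSpace f) (hd : HasRapidSpaceTimeDecay f)
    (hu : IsClassicalNSSolutionOn (Ico 0 τ) ν f u p)
    {E₀ : ℝ≥0∞} (hE₀ : E₀ < ⊤) (hEb : ∀ t ∈ Ico 0 τ, ∫⁻ x, ‖u t x‖ₑ ^ 2 ≤ E₀)
    (hTao : ∀ τ₁ ∈ Ioo 0 τ, HasBoundedSobolevNormsOn (Icc 0 τ₁) u)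
    (hmax : ¬ HasFiniteEnergyExtensionPast ν f u τ) :
    ∃ c : ℝ, 0 < c ∧ ∃ B : ℝ, 0 ≤ B ∧ ∀ t₀ ∈ Ico 0 τ,
      min 1 (c * ν ^ 3 /
        (Real.sqrt (E₀ + ∫⁻ x, ENNReal.ofReal (frobeniusNormSq (fderiv ℝ (u t₀) x))).toReal + B + 1) ^ 4)
        ≤ τ - t₀ := by
  obtain ⟨c, hc, hloc⟩ := tao2011_smooth_local_existence_forced_holds
  obtain ⟨C₀, C₁, B, hB0, -, -, hBf⟩ := exists_force_slice_bounds hs hd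
  refine ⟨c, hc, B, hB0, fun t₀ ht₀ => ?_⟩
  by_contra hlt
  rw [not_le] at hlt
  have hmid : t₀ < (t₀ + τ) / 2 ∧ (t₀ + τ) / 2 < τ := ⟨by linarith [ht₀.2], by linarith [ht₀.2]⟩
  have hHinf : ∀ m : ℕ, ∫⁻ x, ‖iteratedFDeriv ℝ m (u t₀) x‖ₑ ^ 2 < ⊤ := fun m => by
    obtain ⟨C, hC⟩ := hTao _ ⟨ht₀.1.trans_lt hmid.1, hmid.2⟩ m
    exact (hC t₀ ⟨ht₀.1, hmid.1.le⟩).trans_lt ENNReal.coe_lt_top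
  set K : ℝ≥0∞ := ∫⁻ x, ENNReal.ofReal (frobeniusNormSq (fderiv ℝ (u t₀) x)) with hK
  have hKt : K < ⊤ :=
    (lintegral_frobeniusNormSq_le_three_mul_iteratedFDeriv_one (u t₀)).trans_lt
      (ENNReal.mul_lt_top (by simp) (hHinf 1))
  set A : ℝ := Real.sqrt (E₀ + K).toReal with hA
  have hA0 : 0 ≤ A := Real.sqrt_nonneg _
  have hA2 : ENNReal.ofReal (A ^ 2) = E₀ + K := by
    rw [hA, Real.sq_sqrt ENNReal.toReal_nonneg, ENNReal.ofReal_toReal]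
    exact (ENNReal.add_lt_top.2 ⟨hE₀, hKt⟩).ne
  set h : ℝ := min 1 (c * ν ^ 3 / (A + B + 1) ^ 4) with hh
  have hhc : h ≤ c * ν ^ 3 / (A + B + 1) ^ 4 := min_le_right _ _
  have hhpos : 0 < h := lt_min one_pos (by positivity)
  have hhgt : τ - t₀ < h := hlt
  have hsmall : (A + B * h) ^ 4 * h ≤ c * ν ^ 3 := by
    have hh1 : h ≤ 1 := min_le_left _ _
    have h1 : A + B * h ≤ A + B + 1 := by nlinarith
    have h2 : 0 ≤ A + B * h := by positivity
    calc (A + B * h) ^ 4 * h ≤ (A + B + 1) ^ 4 * h :=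
          mul_le_mul_of_nonneg_right (pow_le_pow_left₀ h2 h1 4) hhpos.le
      _ ≤ (A + B + 1) ^ 4 * (c * ν ^ 3 / (A + B + 1) ^ 4) :=
          mul_le_mul_of_nonneg_left hhc (by positivity)
      _ = c * ν ^ 3 := by field_simp
  have hdat : (∫⁻ x, ‖u t₀ x‖ₑ ^ 2) +
      (∫⁻ x, ENNReal.ofReal (frobeniusNormSq (fderiv ℝ (u t₀) x))) ≤ ENNReal.ofReal (A ^ 2) := by
    rw [hA2]; exact add_le_add (hEb t₀ ht₀) le_rfl
  have hfB : ∀ t ∈ Icc 0 h, (∫⁻ x, ‖(fun s => f (s + t₀)) t x‖ₑ ^ 2) +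
      (∫⁻ x, ENNReal.ofReal (frobeniusNormSq (fderiv ℝ ((fun s => f (s + t₀)) t) x))) ≤
        ENNReal.ofReal (B ^ 2) := fun t ht => hBf (t + t₀) (by linarith [ht.1, ht₀.1])
  obtain ⟨w, q, hw, hw0, hwS, -, -, -⟩ := hloc hν hhpos (hu.contDiff_velocity ht₀)
    (hu.divFree t₀ ht₀) hHinf (hs.isSmoothSpaceTimeOn_Icc_timeShift ht₀.1 h)
    (hd.hasUniformRapidDecayOn_Icc_timeShift hs ht₀.1 hhpos) hA0 hB0 hdat hfB hsmall
  have hEw : ∃ C : ℝ≥0∞, C < ⊤ ∧ ∀ t ∈ Icc 0 h, ∫⁻ x, ‖w t x‖ₑ ^ 2 ≤ C :=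
    ClayEvolution.energy_of_hasBoundedSobolevNormsOn hwS
  obtain ⟨T', hT', U, P, hUP, hagree, hEU⟩ := exists_forced_extension_of_piece hν hs hd hu
    ⟨E₀, hE₀, hEb⟩ hTao ht₀.1 ht₀.2 (by linarith) hw hw0 hEw
  exact hmax (hasFiniteEnergyExtensionPast_of_Icc hT' hUP hagree hEU)

end PalasekTowerClayBridge.ForcedContinuation

namespace ClayBlowup

variable {ν : ℝ} (X : ClayBlowup ν)

/-- **LERAY'S `H¹` BLOW-UP RATE for every Clay blow-up** (`ν > 0`; no named fact): there are `c > 0`,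
`B ≥ 0` and a finite `E` with `min(1, c ν³ / (√((E + ∫|∇u(t)|²).toReal) + B + 1)⁴) ≤ T − t` for
every `t ∈ [0, T)` — the enstrophy blows up at least like `(T − t)^{−1/2}` up to the additive
constants. [cite: Leray1934, (3.16)] [cite: Tao2011, Thm. 5.4 (ii)+(iv)] -/
theorem enstrophy_rate (hν : 0 < ν) :
    ∃ c : ℝ, 0 < c ∧ ∃ B : ℝ, 0 ≤ B ∧ ∃ E : ℝ≥0∞, E < ⊤ ∧ ∀ t ∈ Ico 0 X.T,
      min 1 (c * ν ^ 3 /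
        (Real.sqrt (E + ∫⁻ x, ENNReal.ofReal (frobeniusNormSq (fderiv ℝ (X.u t) x))).toReal + B + 1) ^ 4)
        ≤ X.T - t := by
  obtain ⟨E, hEt, hE⟩ := X.energy_le hν
  obtain ⟨c, hc, B, hB, hrate⟩ := ForcedContinuation.lifespan_le_of_no_finiteEnergyExtension hν
    X.force_smooth X.force_decay X.classical hEt hE (X.hasBoundedSobolevNormsOn_subslabs hν)
    X.no_energy_extension
  exact ⟨c, hc, B, hB, E, hEt, hrate⟩

end ClayBlowup

/-! ## §6 The headline: what EVERY proof of (C) must exhibit -/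

/-- **Necessary features of ANY breakdown scenario for Fefferman's (C)** (no named fact): if (C)
holds then at EVERY viscosity `ν > 0` there are a Clay datum and a Clay force whose classical
finite-energy evolution `u` lives exactly on some `[0, T)`, `0 < T < ∞`, with (i) ONE finite bound on
the energy `∫|u(t)|²` for all `t < T` and on `ν∫₀ᵀ∫|∇u|²`, while (ii) `sup_x |u(t, x)|` is unbounded
on every `(t₀, T)` and (iii) the enstrophy `∫|∇u(t)|²` is unbounded on `[0, T)` — Leray's 1934
picture of an époque d'irrégularité, forced version, as a theorem about the Clay statement itself.
[cite: FeffermanClay2006, (C)] [cite: Leray1934, (3.16)] -/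
theorem breakdownR3_necessary
    (h : Summit.NavierStokesRegularity.NavierStokesRegularity.NavierStokesBreakdownR3)
    {ν : ℝ} (hν : 0 < ν) :
    ∃ X : ClayBlowup ν,
      (∃ E : ℝ≥0∞, E < ⊤ ∧ (∀ t ∈ Ico 0 X.T, ∫⁻ x, ‖X.u t x‖ₑ ^ 2 ≤ E) ∧
        ENNReal.ofReal ν *
          ∫⁻ t in Ioo 0 X.T, ∫⁻ x, ENNReal.ofReal (frobeniusNormSq (fderiv ℝ (X.u t) x)) ≤ E) ∧
      (∀ t₀ < X.T, ∀ M : ℝ, ∃ t ∈ Ioo t₀ X.T, ∃ x, M < ‖X.u t x‖) ∧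
      (∀ B : ℝ≥0, ∃ t ∈ Ico 0 X.T,
        (B : ℝ≥0∞) < ∫⁻ x, ENNReal.ofReal (frobeniusNormSq (fderiv ℝ (X.u t) x))) := by
  obtain ⟨X⟩ := forall_nonempty_clayBlowup_of_breakdownR3 h ν hν
  exact ⟨X, X.energy_dissipation_le hν, fun t₀ ht₀ M => X.exists_norm_gt_near hν ht₀ M,
    fun B => X.exists_enstrophy_gt hν B⟩

end Summit.NavierStokesRegularity.FluidComputer

end
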